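import Literature.NumberTheory.EllipticCurves.Hsieh2014.AnticyclotomicPAdicLFunctionRamifiedSteinberg
import Mathlib.NumberTheory.NumberField.Discriminant.Different
import Mathlib.NumberTheory.RamificationInertia.Basic
import HarnessLib

/-!
# Hsieh 2014, Theorems A and B with one `K`-ramified Steinberg prime — the corollaries (proofs only; no
# definition, no named fact): norm-one period, a Thm. A-shaped frame and a frame with `Q ≠ 0` from the Thm. B
# variant, and "NOTHING NEW ON THE ALL-SPLIT RANGE": the configuration (S4′) of
# `Hsieh2014/AnticyclotomicPAdicLFunctionRamifiedSteinberg.lean` (`q ∣ N`, `q ∣ d_K`) EXCLUDES the Heegner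
# hypothesis (S4) of the tree's four all-split Theorem A/B facts

Topic `NumberTheory/EllipticCurves`, sub-directory `Hsieh2014`. Sibling proof file of
`Hsieh2014/AnticyclotomicPAdicLFunctionRamifiedSteinberg.lean` (item wi-88449, cell `bsd-stepL` guest typer
`defn-ty1` g23; consumer stmt-BirchSwinnertonDyer-19358, line `Cruxes/GordTwoRankOne/Lines/wan_tame_bdp_road.lean`,
stub `stub_wanHsiehLowerBoundOverK`), in the pattern of `AnticyclotomicPAdicLFunctionAnyLevelCorollaries.lean`.
§1: kernel bookkeeping between the two named facts of the sibling and frame-shaped consequences (re-read the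
`R₀`-unit period in norm one, `unrIntegers.isUnit_iff_norm_eq_one`; drop / convert the non-vanishing clause,
`ne_zero_of_coeff_norm_eq_one`). §2: a prime `q ∣ d_K` does not split in the quadratic field `K` — Dedekind's
discriminant theorem (Marcus, *Number fields*, Ch. 3 Thm. 34, held text p. 92: "`p` a prime in `ℤ` which divides
`disc(R)`. Then `p` is ramified in `K`"; Mathlib `NumberField.not_dvd_discr_iff_forall_liesOver`) with the
fundamental identity (Marcus Ch. 3 Thm. 21, p. 58: `Σ eᵢfᵢ = n`; Mathlib `Ideal.sum_ramification_inertia`), in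
the `primesOver`/`ncard` currency of `SatisfiesHeegnerHypothesis` (place-indexed tree sibling:
`exists_unique_place_of_dvd_discr`, `QuadraticTwistRamifiedLocalPolynomialProofs.lean`); hence
`¬ SatisfiesHeegnerHypothesis N K` whenever `q ∣ N`, `q ∣ d_K`: the ramified-Steinberg variants and the
all-split facts (`thmA_exists_isHsiehLFunction_unrPeriod_anyLevel`,
`thmB_exists_isHsiehLFunction_coeff_norm_eq_one_unrPeriod_anyLevel` and companions) have DISJOINT hypotheses —
neither variant restates, strengthens or overlaps an existing fact. HONEST FRAMING: proofs only; nothing about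
the named facts themselves, the stub, the crux, the route or BSD is proved. No `def`, no `instance`, no notation.

References: [Hsieh2014] Doc. Math. 19 (2014) Thm. A–B (pp. 712–713) = arXiv:1112.1580 Thm. 1–2 (pp. 3–4);
[CastellaHsieh2018] Math. Ann. 370 §2.5 (the periods in `𝒲^×`); [Marcus2018] D. A. Marcus, *Number fields*,
Universitext (2018), Ch. 3 Thm. 21 (p. 58), Thm. 24 (p. 61), Thm. 25 (p. 63), Thm. 34 (p. 92) — read 2026-08-28
from the held text `book:marcus2018-number-fields`.
-/

noncomputable section

open scoped MatrixGroups ModularForm Topology NumberField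
open CongruenceSubgroup NumberField IsDedekindDomain Field
open Literature.NumberTheory.GaloisRepresentations
open Literature.NumberTheory.EllipticCurves.ModularForms
open Literature.NumberTheory.Automorphic

namespace Literature.NumberTheory.EllipticCurves.Hsieh2014

/-! ### §1. Corollaries (kernel bookkeeping between named facts; nothing asserted) -/

/-- **The Thm. A variant with the period read in norm one** (a unit of `R₀ ⊆ 𝒪_{ℂ_p}` has norm one,
`unrIntegers.isUnit_iff_norm_eq_one`; the shape of `hsieh2014_exists_anticyclotomicPAdicLFunction`'s conclusion).
[cite: Hsieh2014, Thm. A p. 712 (Doc. Math. 19) = Thm. 1 (arXiv:1112.1580 pp. 3–4)]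
[cite: CastellaHsieh2018, §2.5 (arXiv:1505.08165 p. 7)] -/
theorem exists_isHsiehLFunction_norm_eq_one_of_thmA_ramifiedSteinberg
    (h : thmA_exists_isHsiehLFunction_unrPeriod_ramifiedSteinberg)
    {p : ℕ} [Fact p.Prime] (ι : PadicAlgCl p ≃+* ℂ) (K : Type) [Field K] [NumberField K]
    (𝔭 : HeightOneSpectrum (𝓞 K)) (κ : ZpExtension K p) (γ : absoluteGaloisGroup K)
    {N : ℕ} [NeZero N] (W : WeierstrassCurve ℚ) [W.IsElliptic] (f : CuspForm (Gamma0 N) 2)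
    (q : ℕ) [Fact q.Prime] (lam : HeckeCharacter K) (rlam : FramedGaloisRep K (PadicAlgCl p) 1)
    (hp : p ≠ 2) (hf : IsNewformOf W f) (hK : IsImaginaryQuadratic K)
    (hsplit : ((Ideal.span {(p : ℤ)}).primesOver (𝓞 K)).ncard = 2)
    (h𝔭 : ((p : ℕ) : 𝓞 K) ∈ 𝔭.asIdeal)
    (hι : ∀ (w : InfinitePlace K) (k : 𝓞 K), k ∈ 𝔭.asIdeal ↔ ‖ι.symm (w.embedding (k : K))‖ < 1)
    (hqp : q ≠ p) (hqN : q ∣ N) (hq2 : ¬ q ^ 2 ∣ N) (hdisc : (q : ℤ) ∣ NumberField.discr K)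
    (hmult : W.HasMultiplicativeReductionAtPrime q) (hns : ¬ W.HasSplitMultiplicativeReductionAtPrime q)
    (hsplitN : ∀ ℓ : ℕ, ℓ.Prime → ℓ ∣ N → ℓ ≠ q → ((Ideal.span {(ℓ : ℤ)}).primesOver (𝓞 K)).ncard = 2)
    (hu : lam.IsUnitary) (hinf : lam.HasInfinityType (fun _ ↦ (1 : ℤ)) (fun _ ↦ (-1 : ℤ)))
    (htriv : ∀ x : ideleGroup ℚ, lam (AdeleRing.ideleBaseChange ℚ K x) = 1)
    (hunr : ∀ v : HeightOneSpectrum (𝓞 K), ((p : ℕ) : 𝓞 K) ∉ v.asIdeal → lam.IsUnramifiedAt v)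
    (hav : IsPAdicAvatarOf ι lam rlam) (hfac : FactorsThroughZp κ rlam)
    (hκ : κ.IsAnticyclotomic) (hγ : κ.IsTopGenerator γ) :
    ∃ (A : ℝ) (ΩK C : ℂ) (Ωp : ℂ_[p]) (Q : PowerSeries (PadicComplexInt p)),
      0 < A ∧ ΩK ≠ 0 ∧ ‖((ι.symm C : PadicAlgCl p) : ℂ_[p])‖ = 1 ∧ ‖Ωp‖ = 1 ∧
        IsHsiehLFunction ι 𝔭 κ γ f A ΩK C Ωp Q := by
  obtain ⟨A, ΩK, C, Ωp, Q, hA, hΩK, hC, hQ⟩ :=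
    h ι K 𝔭 κ γ W f q lam rlam hp hf hK hsplit h𝔭 hι hqp hqN hq2 hdisc hmult hns hsplitN hu hinf htriv
      hunr hav hfac hκ hγ
  exact ⟨A, ΩK, C, ((Ωp : unrIntegers p) : ℂ_[p]), Q, hA, hΩK, hC,
    (unrIntegers.isUnit_iff_norm_eq_one _).mp Ωp.isUnit, hQ⟩

/-- **Dropping the non-vanishing clause**: the Thm. B variant yields a Thm. A-variant-shaped frame (with the
absolute-irreducibility binder; `IsNewformOf W f`, `R₀`-unit period).
[cite: Hsieh2014, Thm. A and Thm. B (Doc. Math. 19 pp. 712–713)] -/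
theorem exists_isHsiehLFunction_unrPeriod_of_thmB_ramifiedSteinberg
    (h : thmB_exists_isHsiehLFunction_coeff_norm_eq_one_unrPeriod_ramifiedSteinberg)
    {p : ℕ} [Fact p.Prime] (ι : PadicAlgCl p ≃+* ℂ) (K : Type) [Field K] [NumberField K]
    (𝔭 : HeightOneSpectrum (𝓞 K)) (κ : ZpExtension K p) (γ : absoluteGaloisGroup K)
    {N : ℕ} [NeZero N] (W : WeierstrassCurve ℚ) [W.IsElliptic] (f : CuspForm (Gamma0 N) 2)
    (q : ℕ) [Fact q.Prime] (lam : HeckeCharacter K) (rlam : FramedGaloisRep K (PadicAlgCl p) 1)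
    (hp : p ≠ 2) (hf : IsNewformOf W f) (hK : IsImaginaryQuadratic K)
    (hsplit : ((Ideal.span {(p : ℤ)}).primesOver (𝓞 K)).ncard = 2)
    (h𝔭 : ((p : ℕ) : 𝓞 K) ∈ 𝔭.asIdeal)
    (hι : ∀ (w : InfinitePlace K) (k : 𝓞 K), k ∈ 𝔭.asIdeal ↔ ‖ι.symm (w.embedding (k : K))‖ < 1)
    (hqp : q ≠ p) (hqN : q ∣ N) (hq2 : ¬ q ^ 2 ∣ N) (hdisc : (q : ℤ) ∣ NumberField.discr K)
    (hmult : W.HasMultiplicativeReductionAtPrime q) (hns : ¬ W.HasSplitMultiplicativeReductionAtPrime q)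
    (hsplitN : ∀ ℓ : ℕ, ℓ.Prime → ℓ ∣ N → ℓ ≠ q → ((Ideal.span {(ℓ : ℤ)}).primesOver (𝓞 K)).ncard = 2)
    (habs : ∀ ρ : ModPGaloisRep K (ZMod p) 2, (W.baseChange K).IsTorsionGaloisRep p ρ →
      FramedRep.IsAbsolutelyIrreducible ρ)
    (hu : lam.IsUnitary) (hinf : lam.HasInfinityType (fun _ ↦ (1 : ℤ)) (fun _ ↦ (-1 : ℤ)))
    (htriv : ∀ x : ideleGroup ℚ, lam (AdeleRing.ideleBaseChange ℚ K x) = 1)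
    (hunr : ∀ v : HeightOneSpectrum (𝓞 K), ((p : ℕ) : 𝓞 K) ∉ v.asIdeal → lam.IsUnramifiedAt v)
    (hav : IsPAdicAvatarOf ι lam rlam) (hfac : FactorsThroughZp κ rlam)
    (hκ : κ.IsAnticyclotomic) (hγ : κ.IsTopGenerator γ) :
    ∃ (A : ℝ) (ΩK C : ℂ) (Ωp : (unrIntegers p)ˣ) (Q : PowerSeries (PadicComplexInt p)),
      0 < A ∧ ΩK ≠ 0 ∧ ‖((ι.symm C : PadicAlgCl p) : ℂ_[p])‖ = 1 ∧
        IsHsiehLFunction ι 𝔭 κ γ f A ΩK C ((Ωp : unrIntegers p) : ℂ_[p]) Q := by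
  obtain ⟨A, ΩK, C, Ωp, Q, hA, hΩK, hC, hQ, -⟩ :=
    h ι K 𝔭 κ γ W f q lam rlam hp hf hK hsplit h𝔭 hι hqp hqN hq2 hdisc hmult hns hsplitN habs hu hinf
      htriv hunr hav hfac hκ hγ
  exact ⟨A, ΩK, C, Ωp, Q, hA, hΩK, hC, hQ⟩

/-- **The non-vanishing clause read as "`Q ≠ 0`"** (companion's `ne_zero_of_coeff_norm_eq_one`): under the
Thm. B variant there is a frame `(A, Ω_K, C, Ω_p, Q)` with `Q ≠ 0` — the (S_μ)-shaped input of the consumer.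
[cite: Hsieh2014, Thm. B p. 713 (Doc. Math. 19) = Thm. 2 (arXiv:1112.1580 p. 4 l. 24, "non-trivial")] -/
theorem exists_isHsiehLFunction_ne_zero_of_thmB_ramifiedSteinberg
    (h : thmB_exists_isHsiehLFunction_coeff_norm_eq_one_unrPeriod_ramifiedSteinberg)
    {p : ℕ} [Fact p.Prime] (ι : PadicAlgCl p ≃+* ℂ) (K : Type) [Field K] [NumberField K]
    (𝔭 : HeightOneSpectrum (𝓞 K)) (κ : ZpExtension K p) (γ : absoluteGaloisGroup K)
    {N : ℕ} [NeZero N] (W : WeierstrassCurve ℚ) [W.IsElliptic] (f : CuspForm (Gamma0 N) 2)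
    (q : ℕ) [Fact q.Prime] (lam : HeckeCharacter K) (rlam : FramedGaloisRep K (PadicAlgCl p) 1)
    (hp : p ≠ 2) (hf : IsNewformOf W f) (hK : IsImaginaryQuadratic K)
    (hsplit : ((Ideal.span {(p : ℤ)}).primesOver (𝓞 K)).ncard = 2)
    (h𝔭 : ((p : ℕ) : 𝓞 K) ∈ 𝔭.asIdeal)
    (hι : ∀ (w : InfinitePlace K) (k : 𝓞 K), k ∈ 𝔭.asIdeal ↔ ‖ι.symm (w.embedding (k : K))‖ < 1)
    (hqp : q ≠ p) (hqN : q ∣ N) (hq2 : ¬ q ^ 2 ∣ N) (hdisc : (q : ℤ) ∣ NumberField.discr K)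
    (hmult : W.HasMultiplicativeReductionAtPrime q) (hns : ¬ W.HasSplitMultiplicativeReductionAtPrime q)
    (hsplitN : ∀ ℓ : ℕ, ℓ.Prime → ℓ ∣ N → ℓ ≠ q → ((Ideal.span {(ℓ : ℤ)}).primesOver (𝓞 K)).ncard = 2)
    (habs : ∀ ρ : ModPGaloisRep K (ZMod p) 2, (W.baseChange K).IsTorsionGaloisRep p ρ →
      FramedRep.IsAbsolutelyIrreducible ρ)
    (hu : lam.IsUnitary) (hinf : lam.HasInfinityType (fun _ ↦ (1 : ℤ)) (fun _ ↦ (-1 : ℤ)))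
    (htriv : ∀ x : ideleGroup ℚ, lam (AdeleRing.ideleBaseChange ℚ K x) = 1)
    (hunr : ∀ v : HeightOneSpectrum (𝓞 K), ((p : ℕ) : 𝓞 K) ∉ v.asIdeal → lam.IsUnramifiedAt v)
    (hav : IsPAdicAvatarOf ι lam rlam) (hfac : FactorsThroughZp κ rlam)
    (hκ : κ.IsAnticyclotomic) (hγ : κ.IsTopGenerator γ) :
    ∃ (A : ℝ) (ΩK C : ℂ) (Ωp : (unrIntegers p)ˣ) (Q : PowerSeries (PadicComplexInt p)),
      0 < A ∧ ΩK ≠ 0 ∧ ‖((ι.symm C : PadicAlgCl p) : ℂ_[p])‖ = 1 ∧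
        IsHsiehLFunction ι 𝔭 κ γ f A ΩK C ((Ωp : unrIntegers p) : ℂ_[p]) Q ∧ Q ≠ 0 := by
  obtain ⟨A, ΩK, C, Ωp, Q, hA, hΩK, hC, hQ, hn⟩ :=
    h ι K 𝔭 κ γ W f q lam rlam hp hf hK hsplit h𝔭 hι hqp hqN hq2 hdisc hmult hns hsplitN habs hu hinf
      htriv hunr hav hfac hκ hγ
  exact ⟨A, ΩK, C, Ωp, Q, hA, hΩK, hC, hQ, ne_zero_of_coeff_norm_eq_one hn⟩

/-! ### §2. "Nothing new on the all-split range": (S4′) is disjoint from (S4)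

A prime `q ∣ d_K` does not split in the quadratic field `K` (Dedekind: `q ∣ d_K` iff some prime above `q` is
ramified, Mathlib `NumberField.not_dvd_discr_iff_forall_liesOver`; the fundamental identity
`Σ_{𝔔∣q} e_𝔔 f_𝔔 = [K:ℚ] = 2`, Mathlib `Ideal.sum_ramification_inertia`, then forces a single prime above `q`).
Hence no datum `(N, K, q)` satisfies both (S4′) (`q ∣ N`, `q ∣ d_K`) and (S4) (`SatisfiesHeegnerHypothesis N K`):
the two named facts above and the tree's four all-split Theorem A/B facts have DISJOINT hypotheses — neither
variant restates or strengthens an existing fact. Proved; generic in `K` with `[K:ℚ] = 2`. -/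

/-- **In a quadratic field a prime dividing the discriminant does not split into two primes**:
`[K:ℚ] = 2`, `q ∣ d_K` ⟹ `#{𝔔 ∣ q} ≠ 2` (in the `primesOver`/`ncard` currency of `SatisfiesHeegnerHypothesis`;
place-indexed sibling: `exists_unique_place_of_dvd_discr`). Proof: were there two primes above `q`, the
fundamental identity `Σ e f = 2` would give `e = 1` at each, i.e. `q` unramified in `𝓞 K`, contradicting
Dedekind's discriminant theorem (Marcus, *Number fields*, Ch. 3: Thm. 34 "`p ∣ disc(R)` ⟹ `p` is ramified in
`K`", Thm. 21 "`Σ eᵢfᵢ = n`"; for `K = ℚ[√m]`, Thm. 25: `pR = (p, √m)²`).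
[cite: Marcus2018, Ch. 3 Thm. 34 (p. 92) with Thm. 21 (p. 58); Thm. 25 (p. 63)] -/
theorem ncard_primesOver_ne_two_of_dvd_discr (K : Type) [Field K] [NumberField K]
    (hK : Module.finrank ℚ K = 2) {q : ℕ} (hq : q.Prime) (hdisc : (q : ℤ) ∣ NumberField.discr K) :
    ((Ideal.span {(q : ℤ)}).primesOver (𝓞 K)).ncard ≠ 2 := by
  classical
  intro h2
  have hqZ : Prime (q : ℤ) := Nat.prime_iff_prime_int.mp hq
  refine (NumberField.not_dvd_discr_iff_forall_liesOver K (𝓞 K) hqZ).mpr ?_ hdisc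
  intro P hPmax hP
  set p : Ideal ℤ := Ideal.span {(q : ℤ)} with hp_def
  have hp0 : p ≠ ⊥ := by
    simpa [hp_def, Ideal.span_singleton_eq_bot] using hqZ.ne_zero
  haveI hpprime : p.IsPrime := (Ideal.span_singleton_prime hqZ.ne_zero).mpr hqZ
  haveI : p.IsMaximal := hpprime.isMaximal hp0
  haveI := hP
  haveI := hPmax.isPrime
  -- the fundamental identity `Σ_{𝔔 ∣ q} e_𝔔 f_𝔔 = [K : ℚ] = 2`
  have hsum := Ideal.sum_ramification_inertia (R := ℤ) (𝓞 K) ℚ K (p := p) hp0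
  rw [hK] at hsum
  have hPmem : P ∈ IsDedekindDomain.primesOverFinset p (𝓞 K) :=
    (IsDedekindDomain.mem_primesOverFinset_iff hp0 _).mpr ⟨hPmax.isPrime, hP⟩
  have hcard : (IsDedekindDomain.primesOverFinset p (𝓞 K)).card = 2 := by
    rw [← h2, ← IsDedekindDomain.coe_primesOverFinset hp0 (𝓞 K), Set.ncard_coe_finset]
  rw [← Finset.add_sum_erase _ _ hPmem] at hsum
  -- the other prime contributes at least `1`
  have hrest : 1 ≤ ∑ Q ∈ (IsDedekindDomain.primesOverFinset p (𝓞 K)).erase P,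
      p.ramificationIdx' Q * p.inertiaDeg' Q := by
    have hcard' : ((IsDedekindDomain.primesOverFinset p (𝓞 K)).erase P).card = 1 := by
      rw [Finset.card_erase_of_mem hPmem, hcard]
    calc (1 : ℕ) = ((IsDedekindDomain.primesOverFinset p (𝓞 K)).erase P).card • 1 := by
          rw [hcard', smul_eq_mul]
      _ ≤ _ := Finset.card_nsmul_le_sum _ _ _ fun Q hQ ↦ by
        have hQ' := (IsDedekindDomain.mem_primesOverFinset_iff hp0 (𝓞 K)).mp
          (Finset.mem_of_mem_erase hQ)
        haveI := hQ'.1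
        haveI := hQ'.2
        exact Nat.one_le_iff_ne_zero.mpr (mul_ne_zero
          (Ideal.IsDedekindDomain.ramificationIdx'_ne_zero_of_liesOver Q hp0)
          (Ideal.inertiaDeg'_ne_zero p Q))
  -- so `e_P f_P = 1`, whence `e_P = 1`: `P` is unramified over `ℤ`
  have hPterm : p.ramificationIdx' P * p.inertiaDeg' P = 1 := by
    have h1 : 1 ≤ p.ramificationIdx' P * p.inertiaDeg' P :=
      Nat.one_le_iff_ne_zero.mpr (mul_ne_zero
        (Ideal.IsDedekindDomain.ramificationIdx'_ne_zero_of_liesOver P hp0)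
        (Ideal.inertiaDeg'_ne_zero p P))
    omega
  have he : p.ramificationIdx' P = 1 := Nat.eq_one_of_mul_eq_one_right hPterm
  rw [Ideal.ramificationIdx'_eq_ramificationIdx p P hp0] at he
  exact Ideal.ramificationIdx_eq_one_iff.mp he

/-- **(S4′) excludes (S4)**: for an imaginary quadratic `K` and a prime `q ∣ N` with `q ∣ d_K`, the Heegner
hypothesis `SatisfiesHeegnerHypothesis N K` (every prime of `N` splits in `K`) FAILS. So the two named facts of
this file say nothing on the range of the tree's all-split Theorem A/B facts
(`thmA_exists_isHsiehLFunction_unrPeriod_anyLevel`, `thmB_exists_isHsiehLFunction_coeff_norm_eq_one_unrPeriod_anyLevel`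
and their companions), and conversely — Marcus Ch. 3 Thm. 34 + Thm. 21 read against the definition of
`SatisfiesHeegnerHypothesis`. [cite: Marcus2018, Ch. 3 Thm. 34 (p. 92) with Thm. 21 (p. 58)] -/
theorem not_satisfiesHeegnerHypothesis_of_dvd_discr {K : Type} [Field K] [NumberField K]
    (hK : IsImaginaryQuadratic K) {N q : ℕ} (hq : q.Prime) (hqN : q ∣ N)
    (hdisc : (q : ℤ) ∣ NumberField.discr K) : ¬ SatisfiesHeegnerHypothesis N K :=
  fun h ↦ ncard_primesOver_ne_two_of_dvd_discr K hK.1 hq hdisc (h q hq hqN)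

/-- The same exclusion read on the binders of the variants: under (S4′) the split-prime clause
`∀ ℓ ∣ N, ℓ ≠ q → ℓ splits` is the WHOLE splitting content — the excepted prime `q` itself does not split
(`((Ideal.span {(q:ℤ)}).primesOver (𝓞 K)).ncard ≠ 2`), in particular `q ≠ p` for the split `p` is automatic.
[cite: Marcus2018, Ch. 3 Thm. 34 (p. 92) with Thm. 21 (p. 58)] -/
theorem ne_of_dvd_discr_of_ncard_primesOver_eq_two {K : Type} [Field K] [NumberField K]
    (hK : IsImaginaryQuadratic K) {p q : ℕ} (hq : q.Prime) (hdisc : (q : ℤ) ∣ NumberField.discr K)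
    (hsplit : ((Ideal.span {(p : ℤ)}).primesOver (𝓞 K)).ncard = 2) : q ≠ p := by
  rintro rfl
  exact ncard_primesOver_ne_two_of_dvd_discr K hK.1 hq hdisc hsplit

end Literature.NumberTheory.EllipticCurves.Hsieh2014

end
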